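import Mathlib
import HarnessLib
import Literature.AlgebraicGeometry.Ramification.InertiaNormalSylow
import Summits.ResolutionOfSingularities.ResolutionOfSingularities.Theorems.WildQuotientsWildQuotientResolutionToralEndState
import Summits.ResolutionOfSingularities.ResolutionOfSingularities.Theorems.WildQuotientsWildQuotientResolutionAbelianEigenline

/-!
# The Kollár–Szabó eigenline at a point fixed by an abelian subgroup of the inertia (scheme form)
# (crux `WildQuotients.WildQuotientResolution`, stub `stub_phaseZeroHighDim`; any dimension, tame or wild)

Crux stmt-ResolutionOfSingularities-15640 (`WildQuotientResolution`), registered stub `stub_phaseZeroHighDim`.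
Scheme form of ✓`AbelianEigenline.exists_stable_tangentHyperplane` / ✓`exists_eigenParameter` (p826834): for an
action `σ : G →* Aut X` and a point `x` whose local ring is Noetherian, not a field, with algebraically closed
residue field (a closed point of positive codimension on a scheme of finite type over `k = k̄`), and an ABELIAN
subgroup `H ≤ I_x` of the inertia group, the stalk action of `H` on `𝒪_{X,x}` (any package `(a, τ)` as produced by
✓`PointBlowupStalkData.exists_stalkAction`; residue-trivial by ✓`InertLocusStalk.stalkAction_residueTrivial`)
stabilises a TANGENT HYPERPLANE `𝔪_x² ≤ W < 𝔪_x` (codimension one, unit eigenvalue on `𝔪_x/W`) and has an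
EIGEN-PARAMETER `t ∈ 𝔪_x ∖ 𝔪_x²`. This is the first step of Kollár–Szabó «going down» (Reichstein–Youssin 2000,
App., Prop. A.2: the `H`-fixed point `[W]` of the exceptional divisor `ℙ(𝔪_x/𝔪_x²)` of the blow-up of a regular `x`),
on which the negative side-lemma ✓`StandardForm.not_primeOrbitSeparation_of_commuting_conjugates` (p824255) rests
through the named fact `KollarSzaboGoingDown`; it is stated here for the crux objects (`σ`, `inertiaSubgroup`, stalks).

* `exists_stable_tangentHyperplane_of_le_inertia` — the stable hyperplane with unit eigenvalues;
* `exists_eigenParameter_of_le_inertia` — the eigen-parameter.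

[OURS · crux stmt-ResolutionOfSingularities-15640 · helper toward `stub_phaseZeroHighDim` (scheme form of the
Kollár–Szabó eigenline; NOT a proof of the stub); folklore, counted 0; AI-level work, weaker than expert review.]
[folklore]
-/

-- single-problem summit: the doubled namespace component `ResolutionOfSingularities` is forced
set_option linter.dupNamespace false

noncomputable section

namespace Summit.ResolutionOfSingularities.ResolutionOfSingularities.Theorems.WildQuotientResolution.AbelianEigenline

open CategoryTheory AlgebraicGeometry TopologicalSpace IsLocalRing
open Literature.AlgebraicGeometry.Ramification
open Summit.ResolutionOfSingularities.ResolutionOfSingularities.Theorems.WildQuotientResolution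
-- Mathlib's scoped instance `[Group G] [IsMulCommutative G] : CommGroup G` (for the abelian subgroup `H`)
open scoped IsMulCommutative

variable {X : Scheme.{0}} {G : Type} [Group G] (σ : G →* Aut X) (x : X)
  {H : Subgroup G} [IsMulCommutative H]
  (a : H → (X.presheaf.stalk x ⟶ X.presheaf.stalk x))
  (τ : H →* (X.presheaf.stalk x ≃+* X.presheaf.stalk x))
  (hkey : ∀ g : H, Spec.map (a g) ≫ X.fromSpecStalk x = X.fromSpecStalk x ≫ (σ (g : G)).hom)
  (hτ : ∀ (g : H) (r : X.presheaf.stalk x), τ g r = (a g⁻¹).hom r)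

include hkey hτ

/-- **Stable tangent hyperplane at a point fixed by an abelian subgroup of the inertia** (Kollár–Szabó eigenline,
scheme form; crux stmt-ResolutionOfSingularities-15640). For `H ≤ I_x` abelian, `𝒪_{X,x}` Noetherian, not a field,
with algebraically closed residue field, the stalk action `τ` of `H` stabilises an ideal `𝔪_x² ≤ W ≤ 𝔪_x`,
`W ≠ 𝔪_x`, with `W + (t) = 𝔪_x` for every `t ∈ 𝔪_x ∖ W`, and acts on the line `𝔪_x/W` by units:
`τ g t − u t ∈ W`, `u` a unit. [folklore] -/
theorem exists_stable_tangentHyperplane_of_le_inertia [IsNoetherianRing (X.presheaf.stalk x)]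
    [IsAlgClosed (ResidueField (X.presheaf.stalk x))] (hx : ¬ IsField (X.presheaf.stalk x))
    (hH : H ≤ inertiaSubgroup σ x) :
    ∃ W : Ideal (X.presheaf.stalk x),
      maximalIdeal (X.presheaf.stalk x) ^ 2 ≤ W ∧ W ≤ maximalIdeal (X.presheaf.stalk x) ∧
      W ≠ maximalIdeal (X.presheaf.stalk x) ∧
      (∀ t ∈ maximalIdeal (X.presheaf.stalk x), t ∉ W →
        W ⊔ Ideal.span {t} = maximalIdeal (X.presheaf.stalk x)) ∧
      (∀ g : H, ∀ w ∈ W, τ g w ∈ W) ∧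
      ∀ t ∈ maximalIdeal (X.presheaf.stalk x), t ∉ W → ∀ g : H,
        ∃ u : X.presheaf.stalk x, IsUnit u ∧ τ g t - u * t ∈ W := by
  have hres : ∀ (g : H) (s : X.presheaf.stalk x), τ g s - s ∈ maximalIdeal (X.presheaf.stalk x) :=
    InertLocusStalk.stalkAction_residueTrivial σ x a τ hkey hτ hH
  obtain ⟨W, hW2, hWle, hWne, hsup, hstab⟩ := exists_stable_tangentHyperplane τ hres hx
  exact ⟨W, hW2, hWle, hWne, hsup, hstab, fun t ht htW g =>
    exists_unit_mul_sub_mem_of_not_mem τ hres W hW2 hstab ht htW (hsup t ht htW) g⟩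

/-- **Eigen-parameter at a point fixed by an abelian subgroup of the inertia** (scheme form; crux
stmt-ResolutionOfSingularities-15640): some `t ∈ 𝔪_x ∖ 𝔪_x²` satisfies `τ g t ≡ u_g t (mod 𝔪_x²)` for every
`g ∈ H`. [folklore] -/
theorem exists_eigenParameter_of_le_inertia [IsNoetherianRing (X.presheaf.stalk x)]
    [IsAlgClosed (ResidueField (X.presheaf.stalk x))] (hx : ¬ IsField (X.presheaf.stalk x))
    (hH : H ≤ inertiaSubgroup σ x) :
    ∃ t : X.presheaf.stalk x, t ∈ maximalIdeal (X.presheaf.stalk x) ∧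
      t ∉ maximalIdeal (X.presheaf.stalk x) ^ 2 ∧
      ∀ g : H, ∃ u : X.presheaf.stalk x, τ g t - u * t ∈ maximalIdeal (X.presheaf.stalk x) ^ 2 := by
  have hres : ∀ (g : H) (s : X.presheaf.stalk x), τ g s - s ∈ maximalIdeal (X.presheaf.stalk x) :=
    InertLocusStalk.stalkAction_residueTrivial σ x a τ hkey hτ hH
  exact exists_eigenParameter τ hres hx

end Summit.ResolutionOfSingularities.ResolutionOfSingularities.Theorems.WildQuotientResolution.AbelianEigenline

end
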